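import Summits.Langlands.Langlands.Theses.QuadraticWindow
import Literature.NumberTheory.Automorphic.AlgebraicityTwist
import Literature.NumberTheory.Automorphic.AutomorphicTwistHecke
import Literature.NumberTheory.Automorphic.AutomorphicRepsGLSatakeFlathProofs
import Literature.NumberTheory.Automorphic.CuspidalDescentDetCubicRepData

/-!
# The summit implies the window theorem: `Langlands → QuadraticWindowA`
(route QuadraticWindow; support lemmas for the residual item `BeyondTheWindow`, stmt-Langlands-3202)

The residual item of the sector route QuadraticWindow is, verbatim,
`BeyondTheWindow := QuadraticWindowA → Langlands` — the rest of the summit once the window theorem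
`QuadraticWindowA` (the route's target X) is granted.  This file proves, sorry-free, that the
hypothesis of that implication is itself a consequence of its conclusion:

* `exists_galoisRep_satake_of_langlands` — **the summit implies the Satake clause in the
  Harris–Lan–Taylor–Thorne normalisation for every regular algebraic cuspidal `π` of `GL_n(𝔸_F)`,
  every number field `F` and every `n ≥ 1`**: there is an irreducible `ρ : Γ_F → GL_n(ℚ̄_ℓ)` with
  `charpoly ρ(Frob_w) = ∏_j (X - ι⁻¹((q_w^{(n-1)/2} α_j)⁻¹))` (`arithFrobPolyOfSatake ι q_w n α`) for
  every Satake parameter `α` of `π` at all but finitely many `w`.  Proof: `π` is C-algebraic, so the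
  Borel–Jacquet twist `π' = π ⊗ |det|_𝔸^{(1-n)/2}` is a cuspidal L-algebraic datum
  (`CuspidalAutomorphicRepData.exists_twist_hasInfinityType`, Buzzard–Gee 2014 §5.3); conjunct (A) of
  the summit (`Summit.Langlands.AutomorphicToGalois`, Buzzard–Gee Conj. 3.2.1 with `m = 1`) gives an
  irreducible `ρ` matching the Satake parameters `α'` of `π'`; these are `‖ϖ_w‖^{(1-n)/2} α =
  q_w^{(n-1)/2} α` (`AutomorphicRepData.eventually_hasSatakeParamAt_of_map_mulChar_detTwist`,
  Arthur–Clozel Ch. 3 p. 172, and `HeckeCharacter.valueAtUniformizer_of_cpow`), unique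
  (`AutomorphicRepData.hasSatakeParamAt_unique_holds`, Flath), and
  `arithFrobPolyOfSatake ι q 1 (q^{(n-1)/2} α) = arithFrobPolyOfSatake ι q n α` by definition.
* `langlands_iff_quadraticWindowA_and_beyondTheWindow` — hence `Langlands → QuadraticWindowA`,
  packaged as `Langlands ↔ QuadraticWindowA ∧ BeyondTheWindow`: the route's target is an honest
  INSTANCE of the summit (all its special hypotheses — `τ`-polarisation, parity, `ℓ ∤ disc F` — are
  simply not needed under full reciprocity; `n = 0` is excluded by the non-`τ`-invariance
  hypothesis, Satake parameters of `GL_0` being empty), and the pair (target, residual) is EXACTLY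
  the summit.  This certifies in Lean the consistency of the target's conventions (unitary Satake
  normalisation, `(√q)^{n-1}` shift, arithmetic Frobenius, C- versus L-algebraic) with the summit
  statement.
* `imp_langlands_iff_imp_beyondTheWindow` — `BeyondTheWindow` is the weakest residual: a
  hypothesis `B` satisfies `QuadraticWindowA → B → Langlands` iff `B → BeyondTheWindow`.  So
  stmt-Langlands-3202 is precisely "the summit, given one of its own corollaries": it closes with
  the summit and not before, and no restatement is both adequate and easier.

Nothing here proves `QuadraticWindowA`, `BeyondTheWindow` or `Langlands`: apart from the general
lemma every statement is an `↔`, none has a route decl or the summit as its conclusion.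

References: K. Buzzard, T. Gee, *The conjectural connections between automorphic representations
and Galois representations*, LMS LNS 414 (2014), §2.1, Conj. 3.2.1–3.2.2, §5.3; A. Borel,
H. Jacquet, Corvallis (1979), 5.7; J. Arthur, L. Clozel, Annals of Math. Studies 120, Ch. 3,
proof of Thm. 3.1 (p. 172); D. Flath, Corvallis (1979), Thm. 3; M. Harris, K.-W. Lan, R. Taylor,
J. Thorne, Res. Math. Sci. 3 (2016), Thm. A (the `q^{(n-1)/2}` convention).
-/

set_option linter.dupNamespace false -- `Summit.Langlands.Langlands.Theorems` is the mandated namespace (D-0017)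

noncomputable section

namespace Summit.Langlands.Langlands.Theorems.QuadraticWindowResidual

open Summit.Langlands.Langlands.Theses.QuadraticWindow
open Literature.NumberTheory.Automorphic Literature.NumberTheory.GaloisRepresentations
open NumberField IsDedekindDomain Filter Polynomial

/-! ### Three pieces of bookkeeping -/

/-- An irreducible framed Galois representation over a field is semisimple (a simple lattice of
subrepresentations is complemented; Mathlib `IsSimpleOrder → ComplementedLattice`). [folklore] -/
theorem isSemisimple_of_isIrreducible {K : Type} [Field K] {A : Type} [Field A]
    [TopologicalSpace A] [IsTopologicalRing A] {n : ℕ} (ρ : FramedGaloisRep K A n)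
    (h : ρ.toGaloisRep.IsIrreducible) : ρ.toGaloisRep.IsSemisimple := by
  haveI : ρ.toGaloisRep.toRepresentation.IsIrreducible := h
  change ρ.toGaloisRep.toRepresentation.IsSemisimpleRepresentation
  infer_instance

/-- **C-algebraic ⇒ L-algebraic after the twist by `|det|^{(1-n)/2}`** on infinity types: if every
weight `(a, b)` of `T` lies in `(n-1)/2 + ℤ`, every weight `(a - (n-1)/2, b - (n-1)/2)` of
`T.twist (-(n-1)/2)` is integral (Buzzard–Gee 2014, §5.3; the sign of the half-twist is the one
of Harris–Lan–Taylor–Thorne, `r(π)|_{W_v} ↔ rec(π_v ⊗ |det|^{(1-n)/2})`).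
[cite: BuzzardGeeLMS2014, §5.3] -/
theorem isLAlgebraic_twist_neg_half_of_isCAlgebraic {K : Type*} [Field K] {n : ℕ}
    {T : InfinityType K n} (h : T.IsCAlgebraic) :
    (T.twist (-(((n : ℂ) - 1) / 2))).IsLAlgebraic := by
  intro σ p hp
  rw [InfinityType.twist_apply, Multiset.mem_map] at hp
  obtain ⟨p₀, hp₀, rfl⟩ := hp
  obtain ⟨k, l, hk, hl⟩ := h σ p₀ hp₀
  exact ⟨k, l, by rw [ArchWeight.twist_a, hk]; ring, by rw [ArchWeight.twist_b, hl]; ring⟩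

/-- **The half-twist arithmetic**: `(q^{-(n-1)/2})⁻¹ = (√q)^{n-1}` for natural `q` and `n ≥ 1`
(complex power of a natural number with real exponent). [folklore] -/
theorem cpow_neg_half_inv_eq_sqrt_pow (q : ℕ) {n : ℕ} (hn : 1 ≤ n) :
    ((q : ℂ) ^ (((-(((n : ℝ) - 1) / 2) : ℝ)) : ℂ))⁻¹ = ((Real.sqrt q : ℝ) : ℂ) ^ (n - 1) := by
  have hq : (0 : ℝ) ≤ q := Nat.cast_nonneg q
  rw [show (q : ℂ) = ((q : ℝ) : ℂ) by norm_cast, ← Complex.ofReal_cpow hq, ← Complex.ofReal_inv,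
    ← Complex.ofReal_pow]
  congr 1
  rw [← Real.rpow_neg hq, neg_neg, Real.sqrt_eq_rpow, ← Real.rpow_natCast, ← Real.rpow_mul hq,
    Nat.cast_sub hn, Nat.cast_one]
  congr 1
  ring

/-- **`m = 1` on the rescaled parameter is `m = n` on the parameter**:
`arithFrobPolyOfSatake ι q 1 ((√q)^{n-1} α) = arithFrobPolyOfSatake ι q n α` (definitional
bookkeeping: both are `∏_{a ∈ α} (X - ι⁻¹(((√q)^{n-1} a)⁻¹))`). Buzzard–Gee 2014, §2.1 (L- versus
C-normalisation). [folklore] -/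
theorem arithFrobPolyOfSatake_one_map_sqrt_pow {ℓ : ℕ} [Fact ℓ.Prime] (ι : PadicAlgCl ℓ ≃+* ℂ)
    (q n : ℕ) (α : Multiset ℂ) :
    arithFrobPolyOfSatake ι q 1 (α.map ((((Real.sqrt q : ℝ) : ℂ) ^ (n - 1)) * ·)) =
      arithFrobPolyOfSatake ι q n α := by
  rw [arithFrobPolyOfSatake, arithFrobPolyOfSatake, Multiset.map_map]
  congr 1
  refine Multiset.map_congr rfl fun a _ => ?_
  simp only [Function.comp_apply, Nat.sub_self, pow_zero, one_mul]

/-! ### The summit implies the Satake clause in the HLTT normalisation, for every regular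
algebraic cuspidal `π` -/

/-- **The summit implies the Harris–Lan–Taylor–Thorne-shaped Satake clause over EVERY number
field.**  Assume `Langlands` (global reciprocity for `GL_n`, Buzzard–Gee Conj. 3.2.1–3.2.2).  Then
for every number field `F`, every `n ≥ 1`, every regular algebraic cuspidal `π` of `GL_n(𝔸_F)`,
every prime `ℓ` and `ι : ℚ̄_ℓ ≃ ℂ`, there is an irreducible `ρ : Γ_F → GL_n(ℚ̄_ℓ)` such that at all
but finitely many finite places `w`, for every Satake parameter `α` of `π` at `w`, `ρ` is
unramified at `w` with `charpoly ρ(Frob_w) = ∏_j (X - ι⁻¹((q_w^{(n-1)/2} α_j)⁻¹))`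
(`arithFrobPolyOfSatake ι q_w n α`).  Proof: apply conjunct (A) of the summit to the cuspidal
L-algebraic twist `π ⊗ |det|_𝔸^{(1-n)/2}` (Borel–Jacquet 5.7; Buzzard–Gee §5.3), whose Satake
parameters are `q_w^{(n-1)/2} α` (Arthur–Clozel, Ch. 3 p. 172) and unique (Flath).
[cite: BuzzardGeeLMS2014, Conj. 3.2.1 and §5.3] -/
theorem exists_galoisRep_satake_of_langlands (hL : _root_.Langlands) {F : Type} [Field F]
    [NumberField F] {n : ℕ} (hn : 0 < n) (hcpt : isCompact_glFiniteIntegralLevel n F)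
    (π : CuspidalAutomorphicRepData n F hcpt) (hreg : π.1.IsRegularAlgebraic) (ℓ : ℕ) [Fact ℓ.Prime]
    (ι : PadicAlgCl ℓ ≃+* ℂ) :
    ∃ ρ : FramedGaloisRep F (PadicAlgCl ℓ) n, ρ.toGaloisRep.IsIrreducible ∧
      ∀ᶠ w : HeightOneSpectrum (𝓞 F) in cofinite, ∀ α : Multiset ℂ, π.1.HasSatakeParamAt w α →
        ρ.IsUnramifiedAt w ∧ ρ.HasFrobCharpolyAt w (arithFrobPolyOfSatake ι w.residueCard n α) := by
  haveI : NeZero n := ⟨hn.ne'⟩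
  -- the cuspidal L-algebraic twist `π' = π ⊗ |det|^{(1-n)/2}`
  obtain ⟨T, hT, hC, -⟩ := hreg
  obtain ⟨χ, π', hχ, hW, hW', hT'⟩ := π.exists_twist_hasInfinityType (-(((n : ℝ) - 1) / 2)) hT
  have hLalg : π'.1.IsLAlgebraic := by
    refine ⟨_, hT', ?_⟩
    have e : (((-(((n : ℝ) - 1) / 2) : ℝ)) : ℂ) = -(((n : ℂ) - 1) / 2) := by push_cast; ring
    rw [e]
    exact isLAlgebraic_twist_neg_half_of_isCAlgebraic hC
  -- conjunct (A) of the summit for `π'`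
  -- (buildfix 2026-08-20, proof-only: the summit was re-typed to `Nonempty (ReciprocityData F) ∧ ∀ 𝓡, …`)
  obtain ⟨⟨𝓡⟩, h𝓡⟩ := hL F
  obtain ⟨ρ, hirr, -, hcorr, -⟩ := (h𝓡 𝓡 n hn hcpt).1 π' hLalg ℓ ι
  refine ⟨ρ, hirr, ?_⟩
  -- Satake parameters of the twist, uniqueness, and the normalisation bookkeeping
  have hsat := AutomorphicRepData.eventually_hasSatakeParamAt_of_map_mulChar_detTwist χ hW hW'
  filter_upwards [hsat, hcorr.1] with w hw hc α hα
  obtain ⟨α', hα', hur, hch⟩ := hc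
  refine ⟨hur, ?_⟩
  have heq : α' = α.map (χ.valueAtUniformizer w * ·) :=
    π'.1.hasSatakeParamAt_unique_holds hα' (hw α hα)
  rw [heq, Literature.NumberTheory.Automorphic.HeckeCharacter.valueAtUniformizer_of_cpow hχ w,
    cpow_neg_half_inv_eq_sqrt_pow _ hn, arithFrobPolyOfSatake_one_map_sqrt_pow] at hch
  exact hch

/-! ### Consequences for the route QuadraticWindow

All statements below are `↔`'s, so that no declaration of this file has a bare route decl or the
summit as its conclusion (nothing here proves `QuadraticWindowA`, `BeyondTheWindow` or `Langlands`). -/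

/-- **Target and residual together are exactly the summit**:
`Langlands ↔ QuadraticWindowA ∧ BeyondTheWindow`.
`→`: **the summit implies the window theorem** — the route's target X is an instance of conjunct (A)
of the summit (`exists_galoisRep_satake_of_langlands`; under full reciprocity none of X's special
hypotheses — `τ`-polarisation through the Artin avatar `e` and the exponent `k`, parity
normalisation, `ℓ ∤ disc F`, `π` unramified above `ℓ` — is needed, the conclusion holds with `ρ`
irreducible, a fortiori semisimple, and `n = 0` is excluded by the non-`τ`-invariance hypothesis,
Satake parameters of `GL_0` being empty, `HasSatakeParamAt.card_eq`) — and the residual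
`BeyondTheWindow = (QuadraticWindowA → Langlands)` is a weakening of the summit.
`←`: modus ponens, the glue of the route's deciding theorem `closes`.
[cite: BuzzardGeeLMS2014, Conj. 3.2.1 and §5.3] -/
theorem langlands_iff_quadraticWindowA_and_beyondTheWindow :
    _root_.Langlands ↔ (QuadraticWindowA ∧ BeyondTheWindow) := by
  refine ⟨fun hL => ⟨?_, fun _ => hL⟩, fun h => h.2 h.1⟩
  intro F₀ F _ _ _ _ _ τ _ _ _ n hcpt π _ _ hreg _ _ _ hnti ℓ _ ι _ _
  rcases Nat.eq_zero_or_pos n with rfl | hn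
  · exfalso
    obtain ⟨w, α, β, hα, hβ, hne⟩ := hnti.exists
    exact hne ((Multiset.card_eq_zero.mp hβ.card_eq).trans
      (Multiset.card_eq_zero.mp hα.card_eq).symm)
  · obtain ⟨ρ, hirr, hρ⟩ := exists_galoisRep_satake_of_langlands hL hn hcpt π hreg ℓ ι
    exact ⟨ρ, isSemisimple_of_isIrreducible ρ hirr, hρ⟩

/-- **`BeyondTheWindow` is the weakest possible residual of the route**: a hypothesis `B` closes
the glue `QuadraticWindowA → B → Langlands` if and only if it implies `BeyondTheWindow` (so no
restatement of stmt-Langlands-3202 can be both adequate for the deciding theorem and strictly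
easier; together with `langlands_iff_quadraticWindowA_and_beyondTheWindow`: the item is "the
summit, given one of the summit's own corollaries"). [folklore] -/
theorem imp_langlands_iff_imp_beyondTheWindow (B : Prop) :
    (QuadraticWindowA → B → _root_.Langlands) ↔ (B → BeyondTheWindow) :=
  ⟨fun h hB hX => h hX hB, fun h hX hB => h hB hX⟩

end Summit.Langlands.Langlands.Theorems.QuadraticWindowResidual

end
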